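import Summits.Ventures.PercRepro.S1EightSixRankFiveEight

/-!
# PercRepro — THE SHAPE `(rank 3 on 6) ⊕ (rank 5 on 8)` OF THE `(8, 6)` CELL (p2, gen 28; SUBCLAIM-S1 §6.10
(xvii)(p); the last of the eight shapes)

`M` coloop-free of rank `3` on `6` points, `N` coloop-free of rank `5` on `8` points (closures of pairs `≤ 4`
points), all pairs of rank `2`. `#U ≤ 6 N_N(5, 3) + 25 N_N(5, 2) + 160` with `N_N(5, 3) ≤ 56 − t` (a spanning
`5`-set whose complement is a rank-`3` triple) and `N_N(5, 2) ≤ t + s₆`; `#Y ≥ 23 f_N(2) + 38 f_N(3) + 44 f_N(4) +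
22 f_N(5)` with the profile by sizes (`rkSets`), the kill `t + s₅ ≤ 56` (the extension incidence twice: a rank-`2`
triple kills its ten `5`-extensions), `3 t ≤ 40`, `q₂ ≤ 2` (`S1FourLinesOnEight`): `Φ(8, 4) · #U ≤ #Y` (linarith,
margin `≥ 550`). Nothing is claimed about any cell.

* `consumer_arith_three_six_five_eight`, `c025_eight_four_disjointSum_three_six_five_eight` (the profile in `S1EightSixRankFiveEight`).
Axioms: standard.
-/

open scoped Matroid

namespace PercRepro

namespace S1

open Set

variable {α : Type}


/-- The arithmetic of `(rank 3 on 6) ⊕ (rank 5 on 8)` at `(8, 4)`. -/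
theorem consumer_arith_three_six_five_eight {u y t q2 q3 u4 r53 r54 s5 r64 s6 F2 F3 F4 F5 : ℚ}
    (hU : u ≤ 6 * (56 - t) + 25 * (t + s6) + 160) (hY : 23 * F2 + 38 * F3 + 44 * F4 + 22 * F5 ≤ y)
    (hF2 : 28 + t + q2 ≤ F2) (hF3 : 56 - t + q3 + r53 ≤ F3) (hF4 : u4 + r54 + r64 ≤ F4) (hF5 : 9 + s5 + s6 ≤ F5)
    (h4 : 70 ≤ q2 + q3 + u4) (h5 : 56 ≤ r53 + r54 + s5) (h6 : 28 ≤ r64 + s6) (hkill : t + s5 ≤ 56)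
    (ht : 3 * t ≤ 40) (hq2 : q2 ≤ 2) (hs6 : s6 ≤ 28) (hu4 : 0 ≤ u4) (hr54 : 0 ≤ r54) : 76 / 15 * u ≤ y := by
  linarith

/-- **`M ⊕ N` at `(8, 4)`**: `M` coloop-free of rank `3` on `6` points, `N` coloop-free of rank `5` on `8` points,
both with all pairs of rank `2`. -/
theorem c025_eight_four_disjointSum_three_six_five_eight (M N : Matroid α) [M.Finite] [N.Finite]
    (h : Disjoint M.E N.E) (hM : M.eRank = ((3 : ℕ) : ℕ∞)) (hME : M.E.ncard = 6) (hcolM : M.coloops = ∅)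
    (hpairsM : ∀ e ∈ M.E, ∀ f ∈ M.E, e ≠ f → M.eRk {e, f} = 2) (hN : N.eRank = ((5 : ℕ) : ℕ∞))
    (hNE : N.E.ncard = 8) (hcolN : N.coloops = ∅) (hpairsN : ∀ e ∈ N.E, ∀ f ∈ N.E, e ≠ f → N.eRk {e, f} = 2) :
    phiK 8 4 * ({A : Set α | A ⊆ (M.disjointSum N h).E ∧ (M.disjointSum N h).eRk A = ((8 : ℕ) : ℕ∞) ∧
        (M.disjointSum N h).eRk ((M.disjointSum N h).E \ A) = ((4 : ℕ) : ℕ∞)}.ncard : ℚ) ≤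
      ({A : Set α | A ⊆ (M.disjointSum N h).E ∧ ((4 : ℕ) : ℕ∞) < (M.disjointSum N h).eRk A ∧
        (M.disjointSum N h).eRk A < ((8 : ℕ) : ℕ∞)}.ncard : ℚ) := by
  obtain ⟨h53, h52⟩ := complements_rank_five_eight (N := N) hNE
  -- the `U`-side: the slices `(1, 3)`, `(2, 2)`, `(3, 1)`
  have hU : {A : Set α | A ⊆ (M.disjointSum N h).E ∧ (M.disjointSum N h).eRk A = ((8 : ℕ) : ℕ∞) ∧
      (M.disjointSum N h).eRk ((M.disjointSum N h).E \ A) = ((4 : ℕ) : ℕ∞)}.ncard ≤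
      6 * (56 - (rankTwoSets N 3).ncard) + 25 * ((rankTwoSets N 3).ncard + (rkSets N 6 5).ncard) + 160 := by
    rw [disjointSum_ncard_U_eq_finsum M N h 8 4, finsum_mem_coe_finset]
    have hsub : ({(3, 1), (3, 2), (3, 3)} : Finset (ℕ × ℕ)) ⊆ Finset.range (8 + 1) ×ˢ Finset.range (4 + 1) := by
      decide
    rw [← Finset.sum_subset hsub ?_]
    · rw [Finset.sum_insert (by decide), Finset.sum_insert (by decide), Finset.sum_singleton]
      dsimp only
      show (profileSet M 3 1).ncard * (profileSet N 5 3).ncard + ((profileSet M 3 2).ncard * (profileSet N 5 2).ncard +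
        (profileSet M 3 3).ncard * (profileSet N 5 1).ncard) ≤ _
      have h31 := ncard_profileSet_top_one_le_of_pairs' hpairsM 3
      rw [hME] at h31
      have hT := three_mul_ncard_rankTwoTriples_le hM hcolM hpairsM hME
      have h32 := ncard_profileSet_three_two_le_add (M := M) hME
      have h32' : (profileSet M 3 2).ncard ≤ 25 := by omega
      have h33 := ncard_profileSet_le_choose_of_ncard_eq (N := M) (a := 3) (b := 3) hME
      rw [show Nat.choose (3 + 3) 3 = 20 by decide] at h33
      have g51 := ncard_profileSet_top_one_le_of_pairs' hpairsN 5
      rw [hNE] at g51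
      have e1 := Nat.mul_le_mul h31 (show (profileSet N 5 3).ncard ≤ 56 - (rankTwoSets N 3).ncard by omega)
      have e2 := Nat.mul_le_mul h32' h52
      have e3 := Nat.mul_le_mul h33 g51
      omega
    · rintro ⟨a, b⟩ hmem hnot
      rw [Finset.mem_product, Finset.mem_range, Finset.mem_range] at hmem
      simp only [Finset.mem_insert, Finset.mem_singleton, Prod.mk.injEq, not_or] at hnot
      dsimp only
      rcases Nat.lt_or_ge 3 a with ha | ha
      · rw [profileSet_eq_empty_of_eRank_lt M hM ha b, ncard_empty, zero_mul]
      rcases Nat.lt_or_ge a 3 with ha' | ha'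
      · have h8a : 5 < 8 - a := by omega
        rw [profileSet_eq_empty_of_eRank_lt N hN h8a (4 - b), ncard_empty, mul_zero]
      have ha3 : a = 3 := by omega
      subst ha3
      rw [show (8 : ℕ) - 3 = 5 from rfl]
      rcases Nat.lt_or_ge b 1 with hb | hb
      · have hb0 : b = 0 := by omega
        subst hb0
        rw [profileSet_eq_empty_of_ncard_lt N (by rw [hNE]; norm_num : N.E.ncard < 5 + (4 - 0)), ncard_empty,
          mul_zero]
      · have hb4 : 3 < b := by omega
        rw [profileSet_eq_empty_of_eRank_lt_snd M hM hb4 3, ncard_empty, zero_mul]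
  -- the `Y`-side
  have hY : 23 * (rankSet N 2).ncard + 38 * (rankSet N 3).ncard + 44 * (rankSet N 4).ncard +
      22 * (rankSet N 5).ncard ≤
      {A : Set α | A ⊆ (M.disjointSum N h).E ∧ ((4 : ℕ) : ℕ∞) < (M.disjointSum N h).eRk A ∧
        (M.disjointSum N h).eRk A < ((8 : ℕ) : ℕ∞)}.ncard := by
    rw [disjointSum_ncard_Y_eq_finsum M N h 8 4, finsum_mem_coe_finset]
    have hsub : ({(0, 5), (1, 4), (1, 5), (2, 3), (2, 4), (2, 5), (3, 2), (3, 3), (3, 4)} : Finset (ℕ × ℕ)) ⊆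
        (Finset.range 8 ×ˢ Finset.range 8).filter (fun x : ℕ × ℕ => 4 < x.1 + x.2 ∧ x.1 + x.2 < 8) := by
      decide
    refine le_trans ?_ (Finset.sum_le_sum_of_subset hsub)
    rw [Finset.sum_insert (by decide), Finset.sum_insert (by decide), Finset.sum_insert (by decide),
      Finset.sum_insert (by decide), Finset.sum_insert (by decide), Finset.sum_insert (by decide),
      Finset.sum_insert (by decide), Finset.sum_insert (by decide), Finset.sum_singleton]
    dsimp only
    have F3 := ncard_rankSet_three_ge_of_pairs hM hcolM hpairsM hME
    have F2 : 15 ≤ (rankSet M 2).ncard := by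
      have := choose_le_ncard_rankSet_two_of_pairs hpairsM
      rwa [hME, show Nat.choose 6 2 = 15 by decide] at this
    have F1 : 6 ≤ (rankSet M 1).ncard := by
      have := ncard_le_ncard_rankSet_one_of_pairs hpairsM (by omega)
      rwa [hME] at this
    have F0 : 1 ≤ (rankSet M 0).ncard := by
      have h0 : (∅ : Set α) ∈ rankSet M 0 := ⟨empty_subset _, by rw [M.eRk_empty]; rfl⟩
      exact (ncard_pos (rankSet_finite M 0)).mpr ⟨∅, h0⟩
    have e05 := Nat.mul_le_mul_right (rankSet N 5).ncard F0
    have e14 := Nat.mul_le_mul_right (rankSet N 4).ncard F1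
    have e15 := Nat.mul_le_mul_right (rankSet N 5).ncard F1
    have e23 := Nat.mul_le_mul_right (rankSet N 3).ncard F2
    have e24 := Nat.mul_le_mul_right (rankSet N 4).ncard F2
    have e25 := Nat.mul_le_mul_right (rankSet N 5).ncard F2
    have e32 := Nat.mul_le_mul_right (rankSet N 2).ncard F3
    have e33 := Nat.mul_le_mul_right (rankSet N 3).ncard F3
    have e34 := Nat.mul_le_mul_right (rankSet N 4).ncard F3
    linarith
  obtain ⟨hF2, hF3, hF4, hF5⟩ := profile_rank_five_eight hN hNE hcolN hpairsN
  obtain ⟨h4, h5, h6⟩ := partitions_rank_five_eight hN hNE hcolN hpairsN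
  have hkill := kill_bound_rank_five_eight (N := N) hNE
  have hcl : ∀ x ∈ N.E, ∀ y ∈ N.E, x ≠ y → (N.closure {x, y}).ncard ≤ 4 := by
    intro x hx y hy hxy
    have := ncard_closure_pair_le_of_coloops' N hN (by norm_num) hcolN hpairsN hx hy hxy
    rw [hNE] at this
    omega
  have ht := three_mul_ncard_rankTwoTriples_le_eight hpairsN hcl hNE
  have hq2 := ncard_rankTwoSets_four_le_two hpairsN hcl hNE
  have hs6 : (rkSets N 6 5).ncard ≤ 28 := by
    have hf6 : {A : Set α | A ⊆ N.E ∧ A.ncard = 6}.Finite := N.ground_finite.finite_subsets.subset (fun _ hA => hA.1)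
    have := ncard_le_ncard (show rkSets N 6 5 ⊆ {A : Set α | A ⊆ N.E ∧ A.ncard = 6} from fun A hA => ⟨hA.1, hA.2.1⟩) hf6
    rwa [ncard_setOf_subset_ncard_eq N.ground_finite 6, hNE, show Nat.choose 8 6 = 28 by decide] at this
  have ht56 : (rankTwoSets N 3).ncard ≤ 56 := by omega
  rw [phiK_eight_four]
  generalize hu0 : {A : Set α | A ⊆ (M.disjointSum N h).E ∧ (M.disjointSum N h).eRk A = ((8 : ℕ) : ℕ∞) ∧
      (M.disjointSum N h).eRk ((M.disjointSum N h).E \ A) = ((4 : ℕ) : ℕ∞)}.ncard = u at hU ⊢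
  generalize hy0 : {A : Set α | A ⊆ (M.disjointSum N h).E ∧ ((4 : ℕ) : ℕ∞) < (M.disjointSum N h).eRk A ∧
      (M.disjointSum N h).eRk A < ((8 : ℕ) : ℕ∞)}.ncard = y at hY ⊢
  generalize (rankTwoSets N 3).ncard = t at *
  generalize (rankTwoSets N 4).ncard = q2 at *
  generalize (rkSets N 4 3).ncard = q3 at *
  generalize (rkSets N 4 4).ncard = u4 at *
  generalize (rkSets N 5 3).ncard = r53 at *
  generalize (rkSets N 5 4).ncard = r54 at *
  generalize (rkSets N 5 5).ncard = s5 at *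
  generalize (rkSets N 6 4).ncard = r64 at *
  generalize (rkSets N 6 5).ncard = s6 at *
  generalize (rankSet N 2).ncard = f2 at *
  generalize (rankSet N 3).ncard = f3 at *
  generalize (rankSet N 4).ncard = f4 at *
  generalize (rankSet N 5).ncard = f5 at *
  have hU' : (u : ℚ) ≤ 6 * (56 - t) + 25 * ((t : ℚ) + s6) + 160 := by
    have hc : ((6 * (56 - t) + 25 * (t + s6) + 160 : ℕ) : ℚ) = 6 * (56 - (t : ℚ)) + 25 * ((t : ℚ) + s6) + 160 := by
      push_cast [Nat.cast_sub ht56]; ring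
    rw [← hc]; exact_mod_cast hU
  have hF3' : (56 : ℚ) - t + q3 + r53 ≤ f3 := by
    have hc : ((56 - t + q3 + r53 : ℕ) : ℚ) = (56 : ℚ) - t + q3 + r53 := by
      push_cast [Nat.cast_sub ht56]; ring
    rw [← hc]; exact_mod_cast hF3
  exact consumer_arith_three_six_five_eight (u := (u : ℚ)) (y := (y : ℚ)) (t := (t : ℚ)) (q2 := (q2 : ℚ))
    (q3 := (q3 : ℚ)) (u4 := (u4 : ℚ)) (r53 := (r53 : ℚ)) (r54 := (r54 : ℚ)) (s5 := (s5 : ℚ)) (r64 := (r64 : ℚ))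
    (s6 := (s6 : ℚ)) (F2 := (f2 : ℚ)) (F3 := (f3 : ℚ)) (F4 := (f4 : ℚ)) (F5 := (f5 : ℚ)) hU' (by exact_mod_cast hY)
    (by exact_mod_cast hF2) hF3' (by exact_mod_cast hF4) (by exact_mod_cast hF5) (by exact_mod_cast h4)
    (by exact_mod_cast h5) (by exact_mod_cast h6) (by exact_mod_cast hkill) (by exact_mod_cast ht)
    (by exact_mod_cast hq2) (by exact_mod_cast hs6) (Nat.cast_nonneg u4) (Nat.cast_nonneg r54)

end S1

end PercRepro
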